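import Literature.AlgebraicGeometry.HodgeTheory.BettiUniverseHodgeRiemannPositive
import Literature.AlgebraicGeometry.HodgeTheory.HodgeIndexSurfaceSigned
import Literature.AlgebraicGeometry.HodgeTheory.KaehlerClass
import HarnessLib

/-!
# The light trace is compatible with pull-backs UP TO ITS NORMALISATION: `t_{f^*Ω}(f^*η) = t_Ω(η)`
# (row B3-26 (b3) of the `hodgecm-mathlib` cell, director ruling 2026-08-28T02:21:57Z: a LEMMA, not a fact)

Family `hodge`, layer `Literature/AlgebraicGeometry/HodgeTheory`. Theorems only (no definition, no named fact).
The Betti universe's trace `BettiUniverse.tr hX (2n)` is the coordinate functional along an arbitrarily CHOSEN basis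
vector of the line `H^{2n}(X(ℂ); ℚ)` (`BettiUniverseAxioms`: «no orientation / normalisation is fixed»), so the printed
degree formula `∫_{X'} f^*η = deg f · ∫_X η` (Fulton, *Intersection Theory*, Ex. 1.7.4; for a finite étale `f : X' → X`
of degree `deg f` between smooth projective `n`-folds) has no literal counterpart for `tr`: the two choices on `X` and
on `X'` are unrelated.  What IS meaningful — and all that the consumer (the `ω`-normalised Hodge–Riemann forms on the
Picard modular tower, A-p09/A-p10's (b4)) needs — is the statement for the NORMALISED trace
`t_Ω(η) := tr(η)/tr(Ω)` (choice-free: numerator and denominator carry the same factor), in which the degree CANCELS: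

* `LinearMap.apply_mul_apply_comm_of_finrank_eq_one` — two linear functionals on a LINE are proportional:
  `λ x · μ y = λ y · μ x` (linear algebra).
* `BettiUniverse.trC_pull_mul_trC_comm` — for smooth projective `X` of dimension `n`, ANY smooth projective `X'` and ANY
  morphism `f : X' ⟶ X`: `trC_{X'}(f^*η) · trC_X(Ω) = trC_{X'}(f^*Ω) · trC_X(η)` for all `η, Ω ∈ ℂ ⊗_ℚ H^{2n}(X(ℂ); ℚ)`
  (`H^{2n}(X(ℂ); ℚ)` is a line, `finrank_rat_top`; no hypothesis on `f` — for `dim X' ≠ n` both sides vanish by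
  `tr_of_ne`, and for `f^* = 0` in top degree both sides vanish too).
* `BettiUniverse.trC_pull_div_eq` — the quotient form `trC_{X'}(f^*η) / trC_{X'}(f^*Ω) = trC_X(η) / trC_X(Ω)` when both
  denominators are non-zero (e.g. `Ω = ω ∪ ω` for a Kähler class `ω` with `f^*ω` Kähler, next item).
* `BettiUniverse.trC_cup_self_ne_zero_of_isKaehlerClass` — on a surface, `trC hX 4 ((1 ⊗ ω) ∪ (1 ⊗ ω)) ≠ 0` for
  `ω ∈ H²(X(ℂ); ℚ)` with Kähler complexification (`H_η ∪ H_η = Ω_D ≠ 0` has non-zero top coordinate,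
  `KaehlerRationalDatum.cupProduct_Hη_Hη`, `cTopCoord_topClass_ne_zero`; Voisin I §3.1.3 Cor. 3.9: `[ω]ⁿ ≠ 0`).
The printed degree formula itself (with `deg f`) is therefore NOT vendored; the degree enters the consumer only through
the group-theoretic weights of the components (cover-degree count, B3-02/C5).

## References
* [VoisinHodgeI2002] C. Voisin, *Hodge Theory and Complex Algebraic Geometry I*, CUP 2002, §3.1.3 Cor. 3.9 (`[ω]ⁿ ≠ 0`),
  §5.3.2 Thm. 5.30 and §7.1.2 (top cohomology of a compact connected Kähler manifold is a line).
* [HatcherAT2002] A. Hatcher, *Algebraic Topology*, CUP 2002, §3.3 Thm. 3.26, Cor. 3.37; §3.1 p. 198 (naturality).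
* [Fulton1998IntersectionTheory] W. Fulton, *Intersection Theory*, 2nd ed., Springer 1998, Ex. 1.7.4 (degree formula —
  cited for contrast; not formalised).
-/

noncomputable section

open scoped TensorProduct
open Module
open Literature.AlgebraicTopology.SingularHomology
open Literature.AlgebraicGeometry.Motives (bettiCohomology bettiCup ofRatClassBaseChange ofRatClassBaseChange_tmul)

/-- **Two linear functionals on a line are proportional**: `λ x · μ y = λ y · μ x` for `x, y` in a vector space of
dimension `1`. [cite: HatcherAT2002, §3.3 Cor. 3.37 (the use made of `dim H^{2n} = 1`)] -/
theorem LinearMap.apply_mul_apply_comm_of_finrank_eq_one {K V : Type*} [Field K] [AddCommGroup V] [Module K V]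
    (h : Module.finrank K V = 1) (l m : V →ₗ[K] K) (x y : V) : l x * m y = l y * m x := by
  by_cases hx : x = 0
  · rw [hx, map_zero, map_zero, zero_mul, mul_zero]
  · obtain ⟨c, rfl⟩ := (finrank_eq_one_iff_of_nonzero' x hx).1 h y
    rw [map_smul, map_smul, smul_eq_mul, smul_eq_mul]
    ring

namespace Literature.AlgebraicGeometry.HodgeTheory

namespace BettiUniverse

variable {n m : ℕ} {X X' : Motives.SchemeOver ℂ}

/-- `dim_ℂ (ℂ ⊗_ℚ H^{2n}(X(ℂ); ℚ)) = 1` for `X` smooth projective of dimension `n` (`finrank_rat_top` and base change).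
[cite: HatcherAT2002, §3.3 Thm. 3.26 and Cor. 3.37] [cite: VoisinHodgeI2002, §5.3.2 Thm. 5.30] -/
theorem finrank_complex_baseChange_top (hX : Motives.IsSmoothProjective n X) :
    Module.finrank ℂ (ℂ ⊗[ℚ] bettiCohomology X (2 * n)) = 1 := by
  rw [Module.finrank_baseChange]
  exact finrank_rat_top hX

/-- **The light trace is compatible with pull-backs up to normalisation** (cross-multiplied form): for `X` smooth
projective of dimension `n`, any smooth projective `X'` and any morphism `f : X' ⟶ X`,
`trC_{X'}(f^*η) · trC_X(Ω) = trC_{X'}(f^*Ω) · trC_X(η)` for all `η, Ω ∈ ℂ ⊗_ℚ H^{2n}(X(ℂ); ℚ)` — the functionals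
`trC_{X'} ∘ f^*` and `trC_X` live on a LINE.  This is the orientation-free content of the degree formula
`∫_{X'} f^*η = deg f ∫_X η` available for the light trace (the degree cancels in the quotient).
[cite: HatcherAT2002, §3.3 Cor. 3.37 and §3.1 p. 198] -/
theorem trC_pull_mul_trC_comm (hX : Motives.IsSmoothProjective n X) (hX' : Motives.IsSmoothProjective m X')
    (f : X' ⟶ X) (η Ω : ℂ ⊗[ℚ] bettiCohomology X (2 * n)) :
    trC hX' (2 * n) ((pull f (2 * n)).baseChange ℂ η) * trC hX (2 * n) Ω =
      trC hX' (2 * n) ((pull f (2 * n)).baseChange ℂ Ω) * trC hX (2 * n) η :=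
  LinearMap.apply_mul_apply_comm_of_finrank_eq_one (finrank_complex_baseChange_top hX)
    (trC hX' (2 * n) ∘ₗ (pull f (2 * n)).baseChange ℂ) (trC hX (2 * n)) η Ω

/-- **Quotient form**: `trC_{X'}(f^*η) / trC_{X'}(f^*Ω) = trC_X(η) / trC_X(Ω)` whenever both denominators are non-zero
— the `Ω`-NORMALISED trace `t_Ω(η) = tr(η)/tr(Ω)` satisfies `t_{f^*Ω}(f^*η) = t_Ω(η)`. [cite: HatcherAT2002, §3.3 Cor. 3.37] -/
theorem trC_pull_div_eq (hX : Motives.IsSmoothProjective n X) (hX' : Motives.IsSmoothProjective m X')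
    (f : X' ⟶ X) {Ω : ℂ ⊗[ℚ] bettiCohomology X (2 * n)} (hΩ : trC hX (2 * n) Ω ≠ 0)
    (hΩ' : trC hX' (2 * n) ((pull f (2 * n)).baseChange ℂ Ω) ≠ 0) (η : ℂ ⊗[ℚ] bettiCohomology X (2 * n)) :
    trC hX' (2 * n) ((pull f (2 * n)).baseChange ℂ η) / trC hX' (2 * n) ((pull f (2 * n)).baseChange ℂ Ω) =
      trC hX (2 * n) η / trC hX (2 * n) Ω := by
  rw [div_eq_div_iff hΩ' hΩ, mul_comm (trC hX (2 * n) η)]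
  exact trC_pull_mul_trC_comm hX hX' f η Ω

/-- **`tr(ω ∪ ω) ≠ 0` for a rational Kähler class on a surface**: for `X` smooth projective of dimension `2` and
`ω ∈ H²(X(ℂ); ℚ)` whose complexification is a Kähler class, `trC hX 4 ((1 ⊗ ω) ∪ (1 ⊗ ω)) ≠ 0` — `H_ω ∪ H_ω` is the top
Kähler class `Ω ≠ 0` of a Kähler–rational datum (`KaehlerRationalDatum.cupProduct_Hη_Hη`), whose top coordinate is
non-zero, and the light trace is a non-zero multiple of the top coordinate (`trC_eq_smul_cTopCoord`). So the
normalised trace `t_{ω∪ω}` and the constant `t` of `HodgeRiemann10` are well defined. [cite: VoisinHodgeI2002, §3.1.3 Cor. 3.9] -/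
theorem trC_cup_self_ne_zero_of_isKaehlerClass (hX : Motives.IsSmoothProjective 2 X) (ω : bettiCohomology X 2)
    (hω : IsKaehlerClass 2 X (ofRatClass (Motives.ComplexPoints X) 2 ω)) :
    trC hX 4 (LinearMap.BilinMap.baseChange ℂ (cup X 2 2) (1 ⊗ₜ[ℚ] ω) (1 ⊗ₜ[ℚ] ω)) ≠ 0 := by
  obtain ⟨A, hsm, g, hg, e, he, hem, hH⟩ := hω
  let D : KaehlerRationalDatum 2 X := ⟨A, e, he, hem, g, hg, ω, hH⟩
  have hη : ofRatClassBaseChange (Motives.ComplexPoints X) 2 ((1 : ℂ) ⊗ₜ[ℚ] ω) = D.Hη := by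
    rw [ofRatClassBaseChange_tmul, one_smul]
  have hR : ofRatClassBaseChange (Motives.ComplexPoints X) (2 + 2)
      (LinearMap.BilinMap.baseChange ℂ (cup X 2 2) (1 ⊗ₜ[ℚ] ω) (1 ⊗ₜ[ℚ] ω)) = D.topClass := by
    rw [ofRatClassBaseChange_cup2, hη]
    exact D.cupProduct_Hη_Hη rfl
  have e := trC_eq_smul_cTopCoord hX (LinearMap.BilinMap.baseChange ℂ (cup X 2 2) (1 ⊗ₜ[ℚ] ω) (1 ⊗ₜ[ℚ] ω))
  change trC hX (2 * 2) _ ≠ 0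
  rw [e]
  change (tr hX (2 * 2) (ratTopVec hX) : ℂ) *
      cTopCoord hX (ofRatClassBaseChange (Motives.ComplexPoints X) (2 + 2) _) ≠ 0
  rw [hR]
  exact mul_ne_zero (by exact_mod_cast tr_ratTopVec_ne_zero hX) (D.cTopCoord_topClass_ne_zero hX)

end BettiUniverse

end Literature.AlgebraicGeometry.HodgeTheory

end
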